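import Mathlib
import Literature.NumberTheory.LFunctions.Zhang2022.SkeletonWindowPowers
import Literature.NumberTheory.LFunctions.Zhang2022.TypedSection17
import HarnessLib

/-!
# Zhang (2022) §17: the deduction node `Ded1710` — (17.10) `Φ₃ = −(𝔢₀ + 𝔢₁)𝔞𝔓 + o(𝔓)` from the
# typed displays (17.1), (17.2), u007 + u008 ⇒ (17.5) ⇒ (17.6), (17.7), (17.8) + u024 + u025 ⇒
# u026 ⇒ (17.9) — every bookkeeping inference of §17 as a kernel edge between named nodes

Topic `Literature/NumberTheory/LFunctions/Zhang2022` (Landau–Siegel audit tree; verdict-neutral).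
Y. Zhang, *Discrete mean estimates and the Landau–Siegel zero*, arXiv:2211.02515v1 (2022)
[Zhang2022LandauSiegel] — **an unrefereed manuscript under adjudication**; every hypothesis below is
a typed CLAIM node of the manuscript (`Typed.Section17`, cell file `TypedSection17`), stated not
asserted. DAG node ids of the cell siegel-zhang (plan/DAG.tsv) with locators
`[Z22 p.<page>, (display), tex L<line>]` (`lsz3__2_.tex`). The manuscript's closing inferences of §17,

> [u007] A detailed analysis shows … Since `1∗μ∗χ∗χ∗υ∗1∗1 = ν` [u008], it follows that
> `Φ₃⁺(p) = 𝔢₀pΣ_{n<D⁴}ν(n)²/n + o(p)` (17.5). … Since `(pt₀)^{β₃} = −1 + O(α₁)`, it follows by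
> (17.5), (17.2) and Lemma 17.1 that `Σ_{ψ∈Ψ₁}(p_ψt₀)^{β₃}I₃⁺(ψ) = −𝔢₀𝔞𝔓 + o(𝔓)` (17.6). …
> It follows that [u024] … the right side is equal to `𝔢₁Σ_{l<D⁴}ν(l)²/l + o(1) = 𝔢₁𝔞 + o(1)`
> [u025]. Inserting this into (17.8) gives `Φ₃⁻(p) = 𝔢₁𝔞p + o(p)` [u026]. Since `(pt₀)^{β₂} =
> 1 + O(α₁)`, it follows by (17.7) that `Σ_{ψ∈Ψ₁}(p_ψt₀)^{β₃}I₃⁻(ψ) = 𝔢₁𝔞𝔓 + o(𝔓)` (17.9).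
> Finally, from (17.1), (17.6) and (17.9) we conclude `Φ₃ = −(𝔢₀ + 𝔢₁)𝔞𝔓 + o(𝔓)` (17.10).

(print writes `I₃^±` in (17.6)/(17.9) for the `I₄^±` of (17.1); typed by the correct index), are
proved here as kernel theorems:

| theorem | edge | DAG / locator |
|---|---|---|
| `claim17_pt0beta3_holds`, `claim17_pt0beta2_holds` | the inline claims "`(pt₀)^{β₃} = −1 + O(α₁)`", "`(pt₀)^{β₂} = 1 + O(α₁)`" HOLD (tree `norm_pt0_cpow_beta3_add_one_le` / `…beta2_sub_one_le`, file `SkeletonWindowPowers`) | p.96 L4762 · p.98 L4848 |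
| `eq17_5_of` | `Step17_u007 → (∀χ, Step17_u008 χ) → Eq17_5` — exact: `ν_repl = 𝔢₀·(1∗μ∗χ∗χ∗υ∗1∗1)` (`nuRepl_eq_frake0_mul`) | `Z22:(17.5)` p.96 L4750 |
| `eq17_6_of` | `Eq17_2 → Eq17_5 → Eq17_6` (Lemma 17.1 enters as the tree THEOREM `appBLemma171_holds`, via `sum_nu_sq_div_eventually`; `(pt₀)^{β₃} = −1 + O(α𝓛)`, `𝔞 ≪ 𝓛⁴`, `Σ_{p∼P} p = 𝔓` via `window_sum_eval_beta3`) | `Z22:(17.6)` p.96 L4763 |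
| `step17_u026_of` | `Eq17_8 → Step17_u024 → Step17_u025 → Step17_u026` | `Z22:§17.u026` p.98 L4845 |
| `eq17_9_of` | `Eq17_7 → Step17_u026 → Eq17_9` (via `window_sum_eval_beta2`) | `Z22:(17.9)` p.98 L4849 |
| `eval1710_of` | `Eq17_1 → Eq17_6 → Eq17_9 → Skeleton.Eval1710` (the banked (17.10), BY NAME; `O(ε) = O(e^{−c𝓛¹⁰}) = o(𝔓)` because `𝔓 ≥ D` eventually, `forAllLarge_self_le_frakP`) | `Z22:(17.10)` p.99 L4854 |
| `ded1710_of` | `Eq17_1 → Eq17_2 → Eq17_5 → Eq17_7 → Step17_u026 → Skeleton.Ded1710` | `Z22:(17.10)` |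
| `ded1710_of_steps` | the same from the finer nodes `Eq17_1, Eq17_2, Step17_u007, Step17_u008, Eq17_7, Eq17_8, Step17_u024, Step17_u025` | §17 |

So, modulo the kernel, the banked deduction `Skeleton.Ded1710 c′` (`Prop141 → AppBLemma171 →
Lemma151 c′ → Eval1710 c′`, a hypothesis of `theorem1_of_leaves`) reduces to EXACTLY these analytic
CLAIM nodes of §17: (17.1) (residue theorem with `O(ε)`), (17.2) and (17.7) (contour shift +
`Ψ₁ → Ψ` extension, the "by Proposition 14.1"-type steps), u007 ("a detailed analysis shows",
resting on u005/(17.3)), (17.8), u024 (resting on u019–u023; u023 = the "by Lemma 15.1" step, cell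
GAP row G-L4t6-1) and u025 — with u008 an exact identity (discharged separately by the cell).
Lemma 17.1 is consumed as a theorem; Prop. 14.1 and Lemma 15.1 act only through (17.2)/(17.7) and
u023. WHAT THIS IS NOT: a proof of any of those CLAIM nodes, hence not of (17.10); any claim about
Theorems 1–2 of the source or about Landau–Siegel zeros; nothing here bears on the cell's verdict
on (8.24).

## References

* Y. Zhang, arXiv:2211.02515v1 (2022), §17 (17.1)–(17.10), Lemma 17.1 (App. B).
  [cite: Zhang2022LandauSiegel, §17 (17.10)]
-/

noncomputable section

open Complex Real ComplexConjugate Finset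
open Literature.NumberTheory.LFunctions.Zhang2022.Skeleton
open Literature.NumberTheory.LFunctions.Zhang2022.Typed.Section17

namespace Literature.NumberTheory.LFunctions.Zhang2022.Phi3Eval

/-! ## §1. Eventual helpers -/

section Helpers

variable {D : ℕ}

/-- `M ≤ 𝓛` for all large `D`, in `ForAllLarge` form. [cite: Zhang2022LandauSiegel, §2 p. 4] -/
theorem forAllLarge_le_ell (M : ℝ) : ForAllLarge fun D _ _ => M ≤ ell D := by
  obtain ⟨D₀, h⟩ := exists_nat_forall_le_ell M
  exact ⟨D₀, fun D _ _ hD _ _ => h D hD⟩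

/-- **`𝔓 ≥ D` for all large `D`**: the window is non-empty (`𝔓 > 0`, the tree's
`frakP_eventually_pos`) and each `p ∼ P` exceeds `P = exp(𝓛⁹) ≥ exp 𝓛 = D`; so an `O(e^{−c𝓛¹⁰})`
is an `o(𝔓)`. [cite: Zhang2022LandauSiegel, §2 (2.9)] -/
theorem forAllLarge_self_le_frakP : ForAllLarge fun D _ _ => (D : ℝ) ≤ frakP D := by
  obtain ⟨D₀, h⟩ := frakP_eventually_pos
  obtain ⟨D₁, h1⟩ := exists_nat_forall_le_ell 1
  refine ⟨max D₀ D₁, fun D _ _ hD _ _ => ?_⟩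
  have hpos := h D (le_trans (le_max_left _ _) hD)
  have hℓ1 : 1 ≤ ell D := h1 D (le_trans (le_max_right _ _) hD)
  show (D : ℝ) ≤ frakP D
  rw [frakP_eq_sum_primeWindow] at hpos ⊢
  obtain ⟨p, hp⟩ : (primeWindow D).Nonempty := by
    by_contra hne
    rw [Finset.not_nonempty_iff_eq_empty] at hne
    rw [hne, Finset.sum_empty] at hpos
    exact lt_irrefl _ hpos
  have hDpos : (0 : ℝ) < D := by exact_mod_cast Nat.pos_of_ne_zero (NeZero.ne D)
  calc (D : ℝ) = Real.exp (ell D) := by rw [ell, Real.exp_log hDpos]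
    _ ≤ Real.exp (ell D ^ 9) := by
        refine Real.exp_le_exp.mpr ?_
        calc ell D = ell D ^ 1 := (pow_one _).symm
          _ ≤ ell D ^ 9 := pow_le_pow_right₀ hℓ1 (by norm_num)
    _ = bigP D := rfl
    _ ≤ p := (bigP_lt_of_mem_primeWindow hp).le
    _ ≤ ∑ q ∈ primeWindow D, (q : ℝ) := Finset.single_le_sum (fun q _ => Nat.cast_nonneg q) hp

/-- The `n = 0` term of `Σ_{n<D⁴} ν(n)²/n` vanishes: the banked indexing `Finset.range (D⁴)` of
Lemma 17.1 and the typed §17 indexing `Finset.Ico 1 (D⁴)` give the same sum.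
[cite: Zhang2022LandauSiegel, §17 Lemma 17.1] -/
theorem sum_range_nu_sq_div_eq_sum_Ico [NeZero D] (χ : DirichletCharacter ℂ D) :
    ∑ n ∈ Finset.range (D ^ 4), nu χ n ^ 2 / (n : ℂ) =
      ∑ n ∈ Finset.Ico 1 (D ^ 4), nu χ n ^ 2 / (n : ℂ) := by
  have hD : 0 < D ^ 4 := pow_pos (Nat.pos_of_ne_zero (NeZero.ne D)) 4
  rw [Finset.range_eq_Ico, Finset.sum_eq_sum_Ico_succ_bot hD]
  simp

/-- **Lemma 17.1 in the `o(1)` shape with the typed indexing**: `Σ_{1≤n<D⁴} ν(n)²/n = 𝔞 + o(1)`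
under (A) — from the tree THEOREM `appBLemma171_holds` via `sum_nu_sq_div_eventually`.
[cite: Zhang2022LandauSiegel, §17 Lemma 17.1] -/
theorem sum_nu_sq_div_Ico_eventually :
    ∀ δ : ℝ, 0 < δ → ForAllLarge fun D _ χ => AssumptionA D χ →
      ‖(∑ n ∈ Finset.Ico 1 (D ^ 4), nu χ n ^ 2 / (n : ℂ)) - frakA χ‖ ≤ δ := fun δ hδ =>
  (sum_nu_sq_div_eventually δ hδ).mono fun D _ χ _ _ h hA => by
    rw [← sum_range_nu_sq_div_eq_sum_Ico]; exact h hA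

end Helpers

/-! ## §2. The two phase claims of §17 are theorems -/

/-- **"`(pt₀)^{β₃} = −1 + O(α₁)`" (§17 p. 96) HOLDS**: the typed node `Claim17_pt0beta3 c′`, with
`C = 3(520 + |c′|(π + 520))`, from the tree's `norm_pt0_cpow_beta3_add_one_le`.
[cite: Zhang2022LandauSiegel, §17 (17.6) p.96] -/
theorem claim17_pt0beta3_holds (c' : ℝ) : Claim17_pt0beta3 c' := by
  obtain ⟨D₁, h1⟩ := exists_nat_forall_le_ell 2
  refine ⟨3 * (520 + |c'| * (π + 520)), D₁, fun D _ χ hD _ _ p hp => ?_⟩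
  rw [mul_assoc]
  exact norm_pt0_cpow_beta3_add_one_le c' (h1 D hD) hp

variable (c' : ℝ) in
/-- `Claim17_pt0beta3` — `_holds` alias of `claim17_pt0beta3_holds` above under the fact's exact name, stated under the
prover's own binders as section variables (appended 2026-08-28, D-0026 bookkeeping: the proof term is the
existing theorem of this file; no statement, definition or attribute is edited; no new named fact; the
ledger's debt table listed the fact unproved). [cite: Zhang2022LandauSiegel, §17 (17.6) p.96] -/
theorem _root_.Literature.NumberTheory.LFunctions.Zhang2022.Typed.Section17.Claim17_pt0beta3_holds :
    _root_.Literature.NumberTheory.LFunctions.Zhang2022.Typed.Section17.Claim17_pt0beta3 c' :=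
  _root_.Literature.NumberTheory.LFunctions.Zhang2022.Phi3Eval.claim17_pt0beta3_holds (c' := c')

/-- **"`(pt₀)^{β₂} = 1 + O(α₁)`" (§17 p. 98) HOLDS**: the typed node `Claim17_pt0beta2 c′`, with
`C = 2(520 + |c′|(π + 520))`, from the tree's `norm_pt0_cpow_beta2_sub_one_le`.
[cite: Zhang2022LandauSiegel, §17 (17.9) p.98] -/
theorem claim17_pt0beta2_holds (c' : ℝ) : Claim17_pt0beta2 c' := by
  obtain ⟨D₁, h1⟩ := exists_nat_forall_le_ell 2
  refine ⟨2 * (520 + |c'| * (π + 520)), D₁, fun D _ χ hD _ _ p hp => ?_⟩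
  rw [mul_assoc]
  exact norm_pt0_cpow_beta2_sub_one_le c' (h1 D hD) hp

variable (c' : ℝ) in
/-- `Claim17_pt0beta2` — `_holds` alias of `claim17_pt0beta2_holds` above under the fact's exact name, stated under the
prover's own binders as section variables (appended 2026-08-28, D-0026 bookkeeping: the proof term is the
existing theorem of this file; no statement, definition or attribute is edited; no new named fact; the
ledger's debt table listed the fact unproved). [cite: Zhang2022LandauSiegel, §17 (17.9) p.98] -/
theorem _root_.Literature.NumberTheory.LFunctions.Zhang2022.Typed.Section17.Claim17_pt0beta2_holds :
    _root_.Literature.NumberTheory.LFunctions.Zhang2022.Typed.Section17.Claim17_pt0beta2 c' :=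
  _root_.Literature.NumberTheory.LFunctions.Zhang2022.Phi3Eval.claim17_pt0beta2_holds (c' := c')

/-! ## §3. (17.5) from u007 and the identity u008 -/

/-- Scalars pull out of a Dirichlet convolution on the left. [folklore] -/
private theorem convolution_const_mul_left (c : ℂ) (f g : ℕ → ℂ) :
    LSeries.convolution (fun n => c * f n) g = fun n => c * LSeries.convolution f g n := by
  funext n
  simp only [LSeries.convolution_def, Finset.mul_sum, mul_assoc]

/-- Scalars pull out of a Dirichlet convolution on the right. [folklore] -/
private theorem convolution_const_mul_right (c : ℂ) (f g : ℕ → ℂ) :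
    LSeries.convolution f (fun n => c * g n) = fun n => c * LSeries.convolution f g n := by
  funext n
  simp only [LSeries.convolution_def, Finset.mul_sum]
  exact Finset.sum_congr rfl fun q _ => by ring

/-- `ν_repl = 𝔢₀·(1∗μ∗χ∗χ∗υ∗1∗1)` pointwise: the constant `𝔢₀` of the replaced factor `𝔢₀χ(n₂)`
comes out of the six-fold convolution. [cite: Zhang2022LandauSiegel, §17 u007 p.96] -/
theorem nuRepl_eq_frake0_mul {D : ℕ} [NeZero D] (χ : DirichletCharacter ℂ D) (n : ℕ) :
    nuRepl χ n = frake0 *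
      LSeries.convolution
        (LSeries.convolution
          (LSeries.convolution
            (LSeries.convolution
              (LSeries.convolution
                (LSeries.convolution (fun _ => (1 : ℂ)) (fun k => (ArithmeticFunction.moebius k : ℂ)))
                (fun k => χ (k : ZMod D)))
              (fun k => χ (k : ZMod D)))
            (ups χ))
          (fun _ => (1 : ℂ)))
        (fun _ => (1 : ℂ)) n := by
  rw [nuRepl, convolution_const_mul_right, convolution_const_mul_left, convolution_const_mul_left,
    convolution_const_mul_left, convolution_const_mul_left]

/-- **(17.5) from §17.u007 and §17.u008** (§17 p. 96): with u007 typed as (17.3) with the replaced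
coefficients `ν_repl` and u008 the identity `1∗μ∗χ∗χ∗υ∗1∗1 = ν` at every `n ≥ 1` (taken for
every real modulus — it is an unconditional identity of arithmetic functions), (17.5) follows with
the SAME `o(p)`: `Σ_{n<D⁴} ν_repl(n)ν(n)/n = 𝔢₀Σ_{n<D⁴} ν(n)²/n` exactly.
[cite: Zhang2022LandauSiegel, §17 (17.5) p.96] -/
theorem eq17_5_of {c' : ℝ} (h7 : Step17_u007 c')
    (h8 : ∀ (D : ℕ) [NeZero D] (χ : DirichletCharacter ℂ D), Step17_u008 χ) : Eq17_5 c' := by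
  intro ε hε
  obtain ⟨D₀, h⟩ := h7 ε hε
  refine ⟨D₀, fun D _ χ hD hq hp hA p hpw => ?_⟩
  have key : ∑ n ∈ Finset.Ico 1 (D ^ 4), nuRepl χ n * nu χ n / (n : ℂ) =
      frake0 * ∑ n ∈ Finset.Ico 1 (D ^ 4), nu χ n ^ 2 / (n : ℂ) := by
    rw [Finset.mul_sum]
    refine Finset.sum_congr rfl fun n hn => ?_
    rw [nuRepl_eq_frake0_mul, h8 D χ n (Finset.mem_Ico.mp hn).1]
    ring
  have := h D χ hD hq hp hA p hpw
  rwa [key, show (p : ℂ) * (frake0 * ∑ n ∈ Finset.Ico 1 (D ^ 4), nu χ n ^ 2 / (n : ℂ)) =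
    frake0 * (p : ℂ) * ∑ n ∈ Finset.Ico 1 (D ^ 4), nu χ n ^ 2 / (n : ℂ) by ring] at this

/-! ## §4. (17.6), u026, (17.9) -/

/-- **(17.6) from (17.2) and (17.5)** (§17 p. 96: "Since `(pt₀)^{β₃} = −1 + O(α₁)`, it follows by
(17.5), (17.2) and Lemma 17.1 that (17.6)"): the window-sum bookkeeping is the tree's
`window_sum_eval_beta3` (with `c = 𝔢₀`, `X = Σ_{1≤n<D⁴}ν(n)²/n`; it discharges `(pt₀)^{β₃} =
−1 + O(α𝓛)`, `𝔞 ≪ 𝓛⁴`, `Σ_{p∼P} p = 𝔓`), Lemma 17.1 is the tree theorem behind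
`sum_nu_sq_div_Ico_eventually`, and (17.2) moves from `Σ_{p∼P}(pt₀)^{β₃}Φ₃⁺(p)` to
`Σ_{ψ∈Ψ₁}(p_ψt₀)^{β₃}I₄⁺(ψ)`. [cite: Zhang2022LandauSiegel, §17 (17.6) p.96] -/
theorem eq17_6_of {c' : ℝ} (h2 : Eq17_2 c') (h5 : Eq17_5 c') : Eq17_6 c' := by
  have key := window_sum_eval_beta3 c' (Φ := fun D χ p => Phi3plus c' χ p)
    (X := fun D χ => ∑ n ∈ Finset.Ico 1 (D ^ 4), nu χ n ^ 2 / (n : ℂ)) (c := frake0)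
    h5 sum_nu_sq_div_Ico_eventually
  intro ε hε
  have hε2 : 0 < ε / 2 := by positivity
  refine ((h2 _ hε2).and (key _ hε2)).mono fun D _ χ _ _ h hA => ?_
  obtain ⟨e2, e6⟩ := h
  have a := e2 hA
  have b := e6 hA
  beta_reduce at b
  set X : ℂ := ∑ x ∈ finsetOf (PsiOne χ),
    (((x.p : ℝ) * t0 D : ℝ) : ℂ) ^ beta3 c' D * I4 c' χ x (alpha D) with hX
  set Y : ℂ := ∑ p ∈ primeWindow D, (((p : ℝ) * t0 D : ℝ) : ℂ) ^ beta3 c' D * Phi3plus c' χ p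
    with hY
  calc ‖X + frake0 * frakA χ * frakP D‖
      = ‖(X - Y) + (Y + frake0 * frakA χ * frakP D)‖ := by ring_nf
    _ ≤ ‖X - Y‖ + ‖Y + frake0 * frakA χ * frakP D‖ := norm_add_le _ _
    _ ≤ ε / 2 * frakP D + ε / 2 * frakP D := add_le_add a b
    _ = ε * frakP D := by ring

/-- **§17.u026 from (17.8), §17.u024 and §17.u025** (§17 p. 98: "It follows that [u024] … the right
side is equal to `𝔢₁Σ_{l<D⁴}ν(l)²/l + o(1) = 𝔢₁𝔞 + o(1)` [u025]. Inserting this into (17.8) gives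
`Φ₃⁻(p) = 𝔢₁𝔞p + o(p)` [u026]"): with `V = Σ_n(b∗ν₁*)(n)ϱ*(n)/n` (independent of `p`),
`Φ₃⁻(p) = pV + o(p)` uniformly in `p ∼ P` and `V = 𝔢₁𝔞 + o(1)` give u026, uniformly in `p ∼ P`.
[cite: Zhang2022LandauSiegel, §17 u026 p.98] -/
theorem step17_u026_of {c' : ℝ} (h8 : Eq17_8 c') (h24 : Step17_u024 c') (h25 : Step17_u025 c') :
    Step17_u026 c' := by
  intro ε hε
  have hε4 : 0 < ε / 4 := by positivity
  obtain ⟨D₀, h⟩ := ((h8 _ hε4).and (h24 _ hε4)).and (h25 _ hε4)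
  refine ⟨D₀, fun D _ χ hD hq hp hA p hpw => ?_⟩
  obtain ⟨⟨e8, e24⟩, e25⟩ := h D χ hD hq hp
  set V : ℂ := ∑' n : ℕ, bConvNuOne c' χ n * varrho17 c' χ n / (n : ℂ) with hV
  set W : ℂ := ∑ l ∈ Finset.Ico 1 (D ^ 4), nu χ l / (l : ℂ) *
    ∑ q ∈ l.divisorsAntidiagonal, χ (q.1 : ZMod D) * (q.1.divisors.card : ℂ) * nuOneStar c' χ q.2
    with hW
  set R : ℂ := ∑ l ∈ Finset.Ico 1 (D ^ 4), nu χ l ^ 2 / (l : ℂ) with hR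
  have h1 : ‖Phi3minus c' χ p - (p : ℂ) * V‖ ≤ ε / 4 * p := e8 hA p hpw
  have h2 : ‖V - frake 1 * W‖ ≤ ε / 4 := e24 hA
  obtain ⟨h3, h4⟩ := e25 hA
  have hp0 : (0 : ℝ) ≤ p := Nat.cast_nonneg p
  have hV' : ‖V - frake 1 * frakA χ‖ ≤ 3 * (ε / 4) := by
    calc ‖V - frake 1 * frakA χ‖
        = ‖(V - frake 1 * W) + (frake 1 * W - frake 1 * R) + (frake 1 * R - frake 1 * frakA χ)‖ := by
          ring_nf
      _ ≤ ‖V - frake 1 * W‖ + ‖frake 1 * W - frake 1 * R‖ + ‖frake 1 * R - frake 1 * frakA χ‖ :=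
          (norm_add_le _ _).trans (add_le_add (norm_add_le _ _) le_rfl)
      _ ≤ ε / 4 + ε / 4 + ε / 4 := add_le_add (add_le_add h2 h3) h4
      _ = 3 * (ε / 4) := by ring
  calc ‖Phi3minus c' χ p - frake 1 * frakA χ * (p : ℂ)‖
      = ‖(Phi3minus c' χ p - (p : ℂ) * V) + (p : ℂ) * (V - frake 1 * frakA χ)‖ := by ring_nf
    _ ≤ ‖Phi3minus c' χ p - (p : ℂ) * V‖ + ‖(p : ℂ) * (V - frake 1 * frakA χ)‖ := norm_add_le _ _
    _ ≤ ε / 4 * p + p * (3 * (ε / 4)) := by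
        rw [norm_mul, Complex.norm_natCast]
        exact add_le_add h1 (mul_le_mul_of_nonneg_left hV' hp0)
    _ = ε * p := by ring

/-- **(17.9) from (17.7) and §17.u026** (§17 p. 98: "Since `(pt₀)^{β₂} = 1 + O(α₁)`, it follows by
(17.7) that (17.9)"): the window-sum bookkeeping is the tree's `window_sum_eval_beta2` (with
`c = 𝔢₁`, `X = 𝔞`), and (17.7) moves from `Σ_{p∼P}(pt₀)^{β₂}Φ₃⁻(p)` to `Σ_{ψ∈Ψ₁}(p_ψt₀)^{β₃}I₄⁻(ψ)`
(prefactors as printed; `β₃ − β₁ = β₂`). [cite: Zhang2022LandauSiegel, §17 (17.9) p.98] -/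
theorem eq17_9_of {c' : ℝ} (h7 : Eq17_7 c') (h26 : Step17_u026 c') : Eq17_9 c' := by
  -- `X_{D,χ} = 𝔞` as a family over all moduli (the value at `D = 0` is never used)
  have hΦ : ∀ ε : ℝ, 0 < ε → ForAllLarge fun D _ χ => AssumptionA D χ → ∀ p ∈ primeWindow D,
      ‖(fun D χ p => Phi3minus c' χ p) D χ p - frake 1 * p *
        (fun D χ => if h : D = 0 then (0 : ℂ) else ((@frakA D ⟨h⟩ χ : ℝ) : ℂ)) D χ‖ ≤ ε * p := by
    intro ε hε
    refine (h26 ε hε).mono fun D _ χ _ _ h hA p hp => ?_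
    have e := h hA p hp
    beta_reduce
    rw [dif_neg (NeZero.ne D)]
    rwa [show frake 1 * (frakA χ : ℂ) * (p : ℂ) = frake 1 * (p : ℂ) * (frakA χ : ℂ) by ring] at e
  have hX : ∀ δ : ℝ, 0 < δ → ForAllLarge fun D _ χ => AssumptionA D χ →
      ‖(fun D χ => if h : D = 0 then (0 : ℂ) else ((@frakA D ⟨h⟩ χ : ℝ) : ℂ)) D χ - frakA χ‖ ≤ δ := by
    intro δ hδ
    refine ⟨1, fun D _ χ _ _ _ _ => ?_⟩
    beta_reduce
    rw [dif_neg (NeZero.ne D), sub_self, norm_zero]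
    exact hδ.le
  have key := window_sum_eval_beta2 c' (c := frake 1) hΦ hX
  intro ε hε
  have hε2 : 0 < ε / 2 := by positivity
  refine ((h7 _ hε2).and (key _ hε2)).mono fun D _ χ _ _ h hA => ?_
  obtain ⟨e7, e9⟩ := h
  have a := e7 hA
  have b := e9 hA
  beta_reduce at b
  set X : ℂ := ∑ x ∈ finsetOf (PsiOne χ),
    (((x.p : ℝ) * t0 D : ℝ) : ℂ) ^ beta3 c' D * I4 c' χ x (-alpha D) with hXd
  set Y : ℂ := ∑ p ∈ primeWindow D, (((p : ℝ) * t0 D : ℝ) : ℂ) ^ beta2 c' D * Phi3minus c' χ p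
    with hY
  calc ‖X - frake 1 * frakA χ * frakP D‖
      = ‖(X - Y) + (Y - frake 1 * frakA χ * frakP D)‖ := by ring_nf
    _ ≤ ‖X - Y‖ + ‖Y - frake 1 * frakA χ * frakP D‖ := norm_add_le _ _
    _ ≤ ε / 2 * frakP D + ε / 2 * frakP D := add_le_add a b
    _ = ε * frakP D := by ring

/-! ## §5. (17.10) = `Skeleton.Eval1710`, and the deduction node `Ded1710` -/

/-- **(17.10) from (17.1), (17.6) and (17.9)** (§17 p. 99: "Finally, from (17.1), (17.6) and (17.9)
we conclude `Φ₃ = −(𝔢₀ + 𝔢₁)𝔞𝔓 + o(𝔓)` (17.10)"); the conclusion is the banked node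
`Skeleton.Eval1710 c′` BY NAME. The `O(ε)` of (17.1), `ε = e^{−c𝓛¹⁰}`, is `≤ |C| ≤ (ε/3)𝓛 ≤
(ε/3)D ≤ (ε/3)𝔓` for large `D` (`forAllLarge_self_le_frakP`). [cite: Zhang2022LandauSiegel, §17 (17.10) p.99] -/
theorem eval1710_of {c' : ℝ} (h1 : Eq17_1 c') (h6 : Eq17_6 c') (h9 : Eq17_9 c') :
    Eval1710 c' := by
  intro ε hε
  obtain ⟨c₀, hc₀, C, hC⟩ := h1
  have hε3 : 0 < ε / 3 := by positivity
  obtain ⟨D₀, hall⟩ :=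
    (((hC.and (h6 _ hε3)).and (h9 _ hε3)).and forAllLarge_self_le_frakP).and
      (forAllLarge_le_ell (3 * |C| / ε + 1))
  refine ⟨D₀, fun D _ χ hD hq hp hA => ?_⟩
  obtain ⟨⟨⟨⟨e1, e6⟩, e9⟩, hPD⟩, hℓ⟩ := hall D χ hD hq hp
  set Xp : ℂ := ∑ x ∈ finsetOf (PsiOne χ),
    (((x.p : ℝ) * t0 D : ℝ) : ℂ) ^ beta3 c' D * I4 c' χ x (alpha D) with hXp
  set Xm : ℂ := ∑ x ∈ finsetOf (PsiOne χ),
    (((x.p : ℝ) * t0 D : ℝ) : ℂ) ^ beta3 c' D * I4 c' χ x (-alpha D) with hXm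
  have hPnn : 0 ≤ frakP D := frakP_nonneg D
  have hsum : ∑ x ∈ finsetOf (PsiOne χ), (((x.p : ℝ) * t0 D : ℝ) : ℂ) ^ beta3 c' D *
      (I4 c' χ x (alpha D) - I4 c' χ x (-alpha D)) = Xp - Xm := by
    rw [hXp, hXm, ← Finset.sum_sub_distrib]
    exact Finset.sum_congr rfl fun x _ => by ring
  have hb1 : ‖Phi3 c' χ - (Xp - Xm)‖ ≤ ε / 3 * frakP D := by
    have h1' : ‖Phi3 c' χ - (Xp - Xm)‖ ≤ C * Real.exp (-c₀ * ell D ^ 10) := by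
      rw [← hsum]; exact e1 hA
    have hℓ0 : 0 < ell D := by
      have : 0 ≤ 3 * |C| / ε := by positivity
      linarith
    have hexp : Real.exp (-c₀ * ell D ^ 10) ≤ 1 := by
      rw [Real.exp_le_one_iff]
      have : 0 ≤ ell D ^ 10 := by positivity
      nlinarith
    have h2 : C * Real.exp (-c₀ * ell D ^ 10) ≤ |C| :=
      (le_abs_self _).trans (by
        rw [abs_mul, abs_of_nonneg (Real.exp_nonneg _)]
        exact mul_le_of_le_one_right (abs_nonneg _) hexp)
    have hDpos : (0 : ℝ) < D := by exact_mod_cast Nat.pos_of_ne_zero (NeZero.ne D)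
    have hℓD : ell D ≤ D := (Real.log_le_sub_one_of_pos hDpos).trans (by linarith)
    have h3 : |C| ≤ ε / 3 * ell D := by
      have : 3 * |C| / ε ≤ ell D := by linarith
      rw [div_le_iff₀ hε] at this
      linarith
    have h4 : |C| ≤ ε / 3 * frakP D :=
      h3.trans (mul_le_mul_of_nonneg_left (hℓD.trans hPD) hε3.le)
    linarith
  have hb2 : ‖Xp + frake0 * frakA χ * frakP D‖ ≤ ε / 3 * frakP D := e6 hA
  have hb3 : ‖Xm - frake 1 * frakA χ * frakP D‖ ≤ ε / 3 * frakP D := e9 hA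
  have hsplit : Phi3 c' χ + (frake0 + frake 1) * frakA χ * frakP D =
      (Phi3 c' χ - (Xp - Xm)) + (Xp + frake0 * frakA χ * frakP D) -
        (Xm - frake 1 * frakA χ * frakP D) := by ring
  rw [hsplit]
  calc ‖(Phi3 c' χ - (Xp - Xm)) + (Xp + frake0 * frakA χ * frakP D) -
        (Xm - frake 1 * frakA χ * frakP D)‖
      ≤ ‖Phi3 c' χ - (Xp - Xm)‖ + ‖Xp + frake0 * frakA χ * frakP D‖ +
        ‖Xm - frake 1 * frakA χ * frakP D‖ :=
          (norm_sub_le _ _).trans (add_le_add (norm_add_le _ _) le_rfl)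
    _ ≤ ε / 3 * frakP D + ε / 3 * frakP D + ε / 3 * frakP D := add_le_add (add_le_add hb1 hb2) hb3
    _ = ε * frakP D := by ring

/-- **The banked deduction node `Ded1710 c′` from the five typed §17 displays** (17.1), (17.2),
(17.5), (17.7), u026. Of `Ded1710`'s printed inputs, Lemma 17.1 is a THEOREM of the tree (consumed
inside `eq17_6_of`), while Prop. 14.1 and Lemma 15.1 act only through (17.2)/(17.7) and u023 ⇒ u026,
which stay hypotheses. [cite: Zhang2022LandauSiegel, §17 (17.1)–(17.10)] -/
theorem ded1710_of {c' : ℝ} (h1 : Eq17_1 c') (h2 : Eq17_2 c') (h5 : Eq17_5 c') (h7 : Eq17_7 c')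
    (h26 : Step17_u026 c') : Ded1710 c' := fun _ _ _ =>
  eval1710_of h1 (eq17_6_of h2 h5) (eq17_9_of h7 h26)

/-- **`Ded1710 c′` from the finer typed nodes**: (17.1), (17.2), u007 + u008 (⇒ (17.5)), (17.7),
(17.8) + u024 + u025 (⇒ u026). [cite: Zhang2022LandauSiegel, §17 (17.1)–(17.10)] -/
theorem ded1710_of_steps {c' : ℝ} (h1 : Eq17_1 c') (h2 : Eq17_2 c') (h7s : Step17_u007 c')
    (h8s : ∀ (D : ℕ) [NeZero D] (χ : DirichletCharacter ℂ D), Step17_u008 χ)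
    (h7 : Eq17_7 c') (h8 : Eq17_8 c') (h24 : Step17_u024 c') (h25 : Step17_u025 c') :
    Ded1710 c' :=
  ded1710_of h1 h2 (eq17_5_of h7s h8s) h7 (step17_u026_of h8 h24 h25)

/-- **Consequently the banked (17.10) node itself follows from the finer typed §17 nodes** (no
`Ded1710` hypotheses left: Lemma 17.1 is a theorem, Prop. 14.1 / Lemma 15.1 are not consumed
directly). [cite: Zhang2022LandauSiegel, §17 (17.10) p.99] -/
theorem eval1710_of_steps {c' : ℝ} (h1 : Eq17_1 c') (h2 : Eq17_2 c') (h7s : Step17_u007 c')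
    (h8s : ∀ (D : ℕ) [NeZero D] (χ : DirichletCharacter ℂ D), Step17_u008 χ)
    (h7 : Eq17_7 c') (h8 : Eq17_8 c') (h24 : Step17_u024 c') (h25 : Step17_u025 c') :
    Eval1710 c' :=
  eval1710_of h1 (eq17_6_of h2 (eq17_5_of h7s h8s)) (eq17_9_of h7 (step17_u026_of h8 h24 h25))

end Literature.NumberTheory.LFunctions.Zhang2022.Phi3Eval
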